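import Mathlib.Analysis.SpecialFunctions.SmoothTransition
import Summits.AnomalousDissipation.AnomalousDissipation.Theorems.SawtoothPulseCascadeK1LocalisedCascadeStripAverage
import Summits.AnomalousDissipation.AnomalousDissipation.Theorems.SawtoothPulseCascadeK1LocalisedCascadeFarModes

/-!
# K1loc, line `Spectral` — S-D (thin start): THE TRACKED START ENERGY SPLITS INTO STRIP, CONE AND FAR CHANNELS

Helper file of the prover lane on the crux `K1LocalisedCascade` (stmt-AnomalousDissipation-19491), route
`SawtoothPulseCascade` (glue seat k1loc-p3; S-B ↔ S-D hand-over).  The start symbol of every cone ledger (S-B product symbols,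
literal or thin) is `μ(k) = 1 − g_rad(k₀)·(1 − g_cone(k))·g_env(k)` with the three factors in `[0,1]`
(`g_rad = sT((|k₀|−L)/(ε_sL))`, `1 − g_cone = 1 − sT((γ|k₁| − a|k₀|)/(ε_aL))`, `g_env = (1−sT((|k₀|−R)/w))(1−sT((|k₁|−R)/w))`).
Since `1 − xyz ≤ (1−x) + (1−y) + (1−z)` on `[0,1]³`, **`μ² ≤ 3·([|k₀| ≤ (1+ε_s)L] + [a|k₀| ≤ γ|k₁|] + [R ≤ |k₀|] + [R ≤ |k₁|])`**
(`symProdS_sq_le_three_channels`), hence the tracked start energy of any `v` is at most three times the sum of the STRIP channel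
(`…StripAverage.tsum_strip_le_windowAvg`: windowed axis averages, uniform in the number of columns), the STEEP-CONE channel (the
S-D lane's 2-D leakage estimate) and the two FAR channels (`…FarModes`: one partial derivative each) —
`tsum_symProdS_sq_le_three_channels`.  This is the form in which the S-D lane can discharge the hypothesis `hiter` of
`…K1Ledger.From.k1Localised_of_thin_iterate_bound` channel by channel.
WHAT THIS IS NOT: no statement about the cascade; no bound for the cone channel. [cite: ElgindiLissMattingly2025, §1.2.2 (the unstable cone)] [problem: turb]
-/

-- `Summit.<Summit>.<Problem>`: single-conjunct summit, the duplicate namespace segment is deliberate.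
set_option linter.dupNamespace false

noncomputable section

namespace Summit.AnomalousDissipation.AnomalousDissipation.Theorems.SawtoothPulseCascade.K1Start

open Real

/-- `1 − xyz ≤ (1−x) + (1−y) + (1−z)` for `x, y, z ∈ [0,1]`. [folklore] -/
theorem one_sub_mul_three_le {x y z : ℝ} (hx0 : 0 ≤ x) (hx1 : x ≤ 1) (hy0 : 0 ≤ y) (hy1 : y ≤ 1)
    (hz1 : z ≤ 1) : 1 - x * y * z ≤ (1 - x) + (1 - y) + (1 - z) := by
  have h1 : 0 ≤ x * y := mul_nonneg hx0 hy0
  nlinarith [mul_nonneg hx0 (sub_nonneg.2 hy1), mul_nonneg h1 (sub_nonneg.2 hz1), sub_nonneg.2 hx1]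

/-- **The start symbol squared is at most three times the channel indicators**:
`μ(k)² ≤ 3·([|k₀| ≤ (1+ε_s)L] + [a|k₀| ≤ γ|k₁|] + ([R ≤ |k₀|] + [R ≤ |k₁|]))` for
`μ = 1 − sT((|k₀|−L)/(ε_sL))·(1 − sT((γ|k₁| − a|k₀|)/(ε_aL)))·((1−sT((|k₀|−R)/w))(1−sT((|k₁|−R)/w)))`, `ε_s, ε_a, L, w > 0`.
[cite: ElgindiLissMattingly2025, §1.2.2 (the unstable cone)] -/
theorem symProdS_sq_le_three_channels (γ a : ℝ) {εs εa L R w : ℝ} (hεs : 0 < εs) (hεa : 0 < εa) (hL : 0 < L) (hw : 0 < w)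
    (kh kv : ℤ) :
    (1 - smoothTransition ((|(kh : ℝ)| - L) / (εs * L)) * (1 - smoothTransition ((γ * |(kv : ℝ)| - a * |(kh : ℝ)|) / (εa * L))) *
      ((1 - smoothTransition ((|(kh : ℝ)| - R) / w)) * (1 - smoothTransition ((|(kv : ℝ)| - R) / w)))) ^ 2 ≤
      3 * ((if |(kh : ℝ)| ≤ (1 + εs) * L then (1 : ℝ) else 0) + (if a * |(kh : ℝ)| ≤ γ * |(kv : ℝ)| then (1 : ℝ) else 0) +
        ((if R ≤ |(kh : ℝ)| then (1 : ℝ) else 0) + (if R ≤ |(kv : ℝ)| then (1 : ℝ) else 0))) := by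
  set x : ℝ := smoothTransition ((|(kh : ℝ)| - L) / (εs * L)) with hx
  set y : ℝ := 1 - smoothTransition ((γ * |(kv : ℝ)| - a * |(kh : ℝ)|) / (εa * L)) with hy
  set z : ℝ := (1 - smoothTransition ((|(kh : ℝ)| - R) / w)) * (1 - smoothTransition ((|(kv : ℝ)| - R) / w)) with hz
  have hx0 : 0 ≤ x := smoothTransition.nonneg _
  have hx1 : x ≤ 1 := smoothTransition.le_one _
  have hy0 : 0 ≤ y := by rw [hy]; linarith [smoothTransition.le_one ((γ * |(kv : ℝ)| - a * |(kh : ℝ)|) / (εa * L))]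
  have hy1 : y ≤ 1 := by rw [hy]; linarith [smoothTransition.nonneg ((γ * |(kv : ℝ)| - a * |(kh : ℝ)|) / (εa * L))]
  have hz0 : 0 ≤ z := by
    rw [hz]; exact mul_nonneg (by linarith [smoothTransition.le_one ((|(kh : ℝ)| - R) / w)])
      (by linarith [smoothTransition.le_one ((|(kv : ℝ)| - R) / w)])
  have hz1 : z ≤ 1 := by
    rw [hz]
    exact mul_le_one₀ (by linarith [smoothTransition.nonneg ((|(kh : ℝ)| - R) / w)])
      (by linarith [smoothTransition.le_one ((|(kv : ℝ)| - R) / w)])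
      (by linarith [smoothTransition.nonneg ((|(kv : ℝ)| - R) / w)])
  have hμ0 : 0 ≤ 1 - x * y * z := by nlinarith [mul_le_one₀ (mul_le_one₀ hx1 hy0 hy1) hz0 hz1, mul_nonneg hx0 hy0]
  have hμ1 : 1 - x * y * z ≤ (1 - x) + (1 - y) + (1 - z) := one_sub_mul_three_le hx0 hx1 hy0 hy1 hz1
  -- the three channel bounds
  have hA : (1 - x) ^ 2 ≤ (if |(kh : ℝ)| ≤ (1 + εs) * L then (1 : ℝ) else 0) := by
    split_ifs with h
    · nlinarith
    · have h1 : 1 ≤ (|(kh : ℝ)| - L) / (εs * L) := by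
        rw [le_div_iff₀ (by positivity)]; nlinarith
      rw [hx, smoothTransition.one_of_one_le h1]; norm_num
  have hB : (1 - y) ^ 2 ≤ (if a * |(kh : ℝ)| ≤ γ * |(kv : ℝ)| then (1 : ℝ) else 0) := by
    split_ifs with h
    · nlinarith
    · have h1 : (γ * |(kv : ℝ)| - a * |(kh : ℝ)|) / (εa * L) ≤ 0 :=
        div_nonpos_of_nonpos_of_nonneg (by linarith [not_le.mp h]) (by positivity)
      rw [hy, smoothTransition.zero_of_nonpos h1]; norm_num
  have hC : (1 - z) ^ 2 ≤ (if R ≤ |(kh : ℝ)| then (1 : ℝ) else 0) + (if R ≤ |(kv : ℝ)| then (1 : ℝ) else 0) := by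
    by_cases h0 : R ≤ |(kh : ℝ)|
    · rw [if_pos h0]
      have : (1 - z) ^ 2 ≤ 1 := by nlinarith
      have h2 : (0 : ℝ) ≤ (if R ≤ |(kv : ℝ)| then (1 : ℝ) else 0) := by split_ifs <;> norm_num
      linarith
    · by_cases h1 : R ≤ |(kv : ℝ)|
      · rw [if_pos h1, if_neg h0]
        have : (1 - z) ^ 2 ≤ 1 := by nlinarith
        linarith
      · rw [if_neg h0, if_neg h1]
        have e0 : smoothTransition ((|(kh : ℝ)| - R) / w) = 0 :=
          smoothTransition.zero_of_nonpos (div_nonpos_of_nonpos_of_nonneg (by linarith [not_le.mp h0]) hw.le)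
        have e1 : smoothTransition ((|(kv : ℝ)| - R) / w) = 0 :=
          smoothTransition.zero_of_nonpos (div_nonpos_of_nonpos_of_nonneg (by linarith [not_le.mp h1]) hw.le)
        rw [hz, e0, e1]; norm_num
  calc (1 - x * y * z) ^ 2 ≤ ((1 - x) + (1 - y) + (1 - z)) ^ 2 := pow_le_pow_left₀ hμ0 hμ1 2
    _ ≤ 3 * ((1 - x) ^ 2 + (1 - y) ^ 2 + (1 - z) ^ 2) := by
        nlinarith [sq_nonneg ((1 - x) - (1 - y)), sq_nonneg ((1 - y) - (1 - z)), sq_nonneg ((1 - x) - (1 - z))]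
    _ ≤ _ := by linarith

/-- **The tracked start energy splits into the strip, cone and far channels**: for non-negative summable `c`
(e.g. `c(k) = ‖𝓕v(k)‖²`), `Σ' k, μ(k)²c(k) ≤ 3·(Σ'[|k₀| ≤ (1+ε_s)L]c + Σ'[a|k₀| ≤ γ|k₁|]c + Σ'[R ≤ |k₀|]c + Σ'[R ≤ |k₁|]c)`.
[cite: ElgindiLissMattingly2025, §1.2.2 (the unstable cone)] -/
theorem tsum_symProdS_sq_le_three_channels (γ a : ℝ) {εs εa L R w : ℝ} (hεs : 0 < εs) (hεa : 0 < εa) (hL : 0 < L)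
    (hw : 0 < w) {c : (Fin 2 → ℤ) → ℝ} (hc : Summable c) (hc0 : ∀ k, 0 ≤ c k) :
    ∑' k : Fin 2 → ℤ, (1 - smoothTransition ((|((k 0 : ℤ) : ℝ)| - L) / (εs * L)) *
        (1 - smoothTransition ((γ * |((k 1 : ℤ) : ℝ)| - a * |((k 0 : ℤ) : ℝ)|) / (εa * L))) *
        ((1 - smoothTransition ((|((k 0 : ℤ) : ℝ)| - R) / w)) * (1 - smoothTransition ((|((k 1 : ℤ) : ℝ)| - R) / w)))) ^ 2 *
        c k ≤
      3 * (∑' k : Fin 2 → ℤ, (if |((k 0 : ℤ) : ℝ)| ≤ (1 + εs) * L then (1 : ℝ) else 0) * c k +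
        ∑' k : Fin 2 → ℤ, (if a * |((k 0 : ℤ) : ℝ)| ≤ γ * |((k 1 : ℤ) : ℝ)| then (1 : ℝ) else 0) * c k +
        (∑' k : Fin 2 → ℤ, (if R ≤ |((k 0 : ℤ) : ℝ)| then (1 : ℝ) else 0) * c k +
          ∑' k : Fin 2 → ℤ, (if R ≤ |((k 1 : ℤ) : ℝ)| then (1 : ℝ) else 0) * c k)) := by
  -- summability of indicator-weighted series
  have hsI : ∀ (p : (Fin 2 → ℤ) → Prop) [DecidablePred p], Summable fun k => (if p k then (1 : ℝ) else 0) * c k := by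
    intro p _
    refine Summable.of_nonneg_of_le (fun k => mul_nonneg (by split_ifs <;> norm_num) (hc0 k)) (fun k => ?_) hc
    split_ifs <;> simp [hc0 k]
  have hle := fun k : Fin 2 → ℤ =>
    mul_le_mul_of_nonneg_right (symProdS_sq_le_three_channels γ a hεs hεa hL hw (R := R) (k 0) (k 1)) (hc0 k)
  have hR : Summable fun k : Fin 2 → ℤ =>
      3 * ((if |((k 0 : ℤ) : ℝ)| ≤ (1 + εs) * L then (1 : ℝ) else 0) +
        (if a * |((k 0 : ℤ) : ℝ)| ≤ γ * |((k 1 : ℤ) : ℝ)| then (1 : ℝ) else 0) +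
        ((if R ≤ |((k 0 : ℤ) : ℝ)| then (1 : ℝ) else 0) + (if R ≤ |((k 1 : ℤ) : ℝ)| then (1 : ℝ) else 0))) * c k := by
    have h := (((hsI (fun k => |((k 0 : ℤ) : ℝ)| ≤ (1 + εs) * L)).add
      (hsI (fun k => a * |((k 0 : ℤ) : ℝ)| ≤ γ * |((k 1 : ℤ) : ℝ)|))).add
      ((hsI (fun k => R ≤ |((k 0 : ℤ) : ℝ)|)).add (hsI (fun k => R ≤ |((k 1 : ℤ) : ℝ)|)))).mul_left 3
    refine h.congr fun k => ?_
    ring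
  have hL' : Summable fun k : Fin 2 → ℤ => (1 - smoothTransition ((|((k 0 : ℤ) : ℝ)| - L) / (εs * L)) *
      (1 - smoothTransition ((γ * |((k 1 : ℤ) : ℝ)| - a * |((k 0 : ℤ) : ℝ)|) / (εa * L))) *
      ((1 - smoothTransition ((|((k 0 : ℤ) : ℝ)| - R) / w)) * (1 - smoothTransition ((|((k 1 : ℤ) : ℝ)| - R) / w)))) ^ 2 *
      c k := Summable.of_nonneg_of_le (fun k => mul_nonneg (sq_nonneg _) (hc0 k)) hle hR
  refine (Summable.tsum_le_tsum hle hL' hR).trans (le_of_eq ?_)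
  simp_rw [mul_assoc]
  rw [tsum_mul_left]
  congr 1
  have h1 := hsI (fun k => |((k 0 : ℤ) : ℝ)| ≤ (1 + εs) * L)
  have h2 := hsI (fun k => a * |((k 0 : ℤ) : ℝ)| ≤ γ * |((k 1 : ℤ) : ℝ)|)
  have h3 := hsI (fun k => R ≤ |((k 0 : ℤ) : ℝ)|)
  have h4 := hsI (fun k => R ≤ |((k 1 : ℤ) : ℝ)|)
  rw [← h1.tsum_add h2, ← h3.tsum_add h4, ← (h1.add h2).tsum_add (h3.add h4)]
  refine tsum_congr fun k => ?_
  ring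

end Summit.AnomalousDissipation.AnomalousDissipation.Theorems.SawtoothPulseCascade.K1Start
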